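import Summits.QuantumFields.YangMills.Theorems.BalabanUVNodesN15TwoGridDressedDivergenceByParts
import Summits.QuantumFields.YangMills.Theorems.BalabanUVNodesN15FullPropagatorEntry2Rows
import Summits.QuantumFields.YangMills.Theorems.BalabanUVNodesN15BackgroundSiteWords
import HarnessLib

/-!
# N15 (NE2) — PROGRAMME D «THE DRESSED SOURCE-DIVERGENCE ENTRY OF THE PAIR OF RECORD», part D-B: ★★★ THE η-DEFECT OF THE DRESSED SOURCE DIVERGENCE `X∘∇*_κ` FROM LETTERS —
# `𝔇(X′∇′*_κ, X̄∇̄*_κ) ≤ A·(1 − q′)⁻¹·e^{−ρd}` with NO letter on `∇c′`, NO mixed row `∇G∇*`, NO fit of `c′` or of `∇a′`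

WHO ∕ WHEN.  Cell `pub-ymgap`, seat `pub-ymgap-dag-n15-a` (KNIT-BY-NAME seat of Track-A DAG node N15 = NE2, g26); `--kind proof --supports stmt-QuantumFields-27366 --as helper` (K3⁸;
count-neutral).  THEOREMS ONLY (0 `def`).  Over D-A `…TwoGridDressedDivergenceByParts` (`comp_firstOrder_eq_translate`, `mulOp_sub_sum_mulOp`, `bgPairDiv_fix`), II-B `…TwoGridFirstOrderLetters` (`hasMaj_bgPair_comp`,
`hasMaj_byPartsStep`, `hasMaj_mulOp_comp`, `hasMaj_comp_diagK_const`), n15-c W `…FullPropagatorEntry2Rows` (`symbOp_sT_eq_pull`, `hasMaj_fshift_comp`, `hasMaj_idefFShift_comp`), n15-b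
(`hasMaj_step`, `hasMaj_exp_mono`, `abs_blockAvg_le`), `T4EtaRateDefect` (`idef_fix`), `T4EtaRateCoeffDefect` (`hasMaj_idef_mulOp`), `B9SectDWeightedNeumann`
(`wrow_of_exp`, `neumann_majorant_wrow`), `B11SectG.hasMaj_comp_exp`, part 3 `hasMaj_finsum`, `DerivDefect.exists_const_hasMaj_ofBlocks` BY NAME; nothing in the tree is modified.

THE PRINT (MECHANISM and SHAPES only; nothing of [B9] asserted).  [Balaban1985BackgroundPropagators] Thm 3.1 (3.42) p.397 (the third sup entry `|(G(U)∇*_Uλ)(x)|`), (3.52) p.400 (`Δ_A = Δ + V′(A)`,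
`V′` first order), (3.62)–(3.65) pp.402–403 (step bound, Neumann series, resolvent identity), (3.35) p.396 («|A| < O(1)Mα₀(L^jη)^{−1}, |∇^ηA| < O(1)Mα₀(L^jη)^{−2}» — the letters: sups of the
coefficients and of their FIRST difference quotients).  [King1986] p.664 (the pairing `x′ ∈ B(x)`).

WHAT.  §20 ★★★ `hasMaj_idef_dressedDiv_of_letters`: on King's torus carriers (`n = L^k`, `n′ = L^mL^k`, pairing `P = pull kingPrV`), for coarse ∕ fine pieces `G, G′` with `U ≡ 1` rows —
values `≤ βe^{−δd}`, gradient rows `∇G, ∇′G′ ≤ βe^{−δd}`, fine source-gradient rows `G′∇′_μ ≤ C₂e^{−δd}`, fine source-divergence rows `S′_μ := G′∇′*_μ ≤ C₁e^{−δd}`, the η-defects `𝔇(G′, G) ≤ m_Ge^{−δd}`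
and `𝔇(S′_μ, S_μ) ≤ m_Se^{−δd}` (ALL directions) — and a fine first-order coefficient family `(c′, a′_μ)` with `|c′|, |a′_μ| ≤ r`, `|∇′⁻_μa′_μ| ≤ r_b`, `|a′_μ − ā_μ∘π| ≤ o_a`, coarse partner
`(c̄, ā) = blockAvg`, `|∇̄⁻_μā_μ| ≤ r_b`; PLUS three COMPOSITE letters about the coarse dressed source divergence `Ȳ := X̄∘∇̄*_κ` (`X̄ = (1 − ḠV̄₁)⁻¹Ḡ` realised as the value component of n15-b's
`bgPair`): its majorant `Ȳ ≤ β_Y e^{−ρd}`, its ONE-STEP letters `(τ̄_ι − 1)∘Ȳ ≤ H_Y e^{−ρd}` (Hölder: `H_Y` small), and the JUNK letters `G′∘𝔇(M_{b′_μ}, M_{b̄_μ})∘Ȳ ≤ ζ_b e^{−ρd}` of the by-parts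
remainders (`b′_μ = ∇′⁻_μa′_μ` fine, `b̄_μ = ∇̄⁻_μā_μ` the coarse species' OWN remainder — not a block average); and the NO-FIT row `G′∘𝔇(M_{c′}, M_{c̄}) ≤ ζ_c e^{−δd}` (M-C's shape, `c̄ = blockAvg c′`).
CONCLUSION, under the two contraction guards: `𝔇(X′∇′*_κ, X̄∇̄*_κ) ≤ A·(1 − q′)⁻¹·e^{−ρd}`, `q′ = (βr + (d+1)(C₂r + βr_b))c_r`,
`A = m_S + m_G R_w β_Y c_r + ζ_c β_Y c_r + (d+1)ζ_b + (d+1)·[m_S·r β_Y e^{ρ}·c_r + C₁ o_a·β_Y e^{ρ}·c_r + C₁ r·H_Y·c_r]`, `R_w = r + (d+1)r_b` — EVERY summand carries a rate-small letter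
(`m_S, m_G, ζ_c, ζ_b, o_a, H_Y`); NO «∇G∇*», NO `∇c′`, NO `∇∇a′`, NO fit of `c′` or of `∇⁻a′`.
HOW.  D-A: `Y = G∇*_κ + (GV₁)Y` on both grids and the step in translation form `GV₁ = G(M_c − Σ_μM_{b_μ}) − Σ_μ S_μ M_{a_μ} τ_μ`; `idef_fix`; `𝔇(G′V₁′, ḠV̄₁)Ȳ` expands (`idef_translate_expand`)
into: `𝔇(G)(M_{c̄} − ΣM_{b̄})Ȳ`, the no-fit row `∘Ȳ`, the junk letters, and per direction `𝔇(S_μ)M_āτ̄Ȳ`, `S′_μ𝔇(M_{a′},M_ā)τ̄Ȳ` (pointwise fit), `S′_μM_{a′}𝔇(τ′,τ̄)Ȳ` — the last majorised by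
the one-step letter of `Ȳ` (n15-c `hasMaj_idefFShift_comp`); `neumann_majorant_wrow` with the step majorant of II-B `hasMaj_byPartsStep`.

HONEST FRAMING ∕ LIMITS.  Entry 2 (source divergence) of the pair; block-majorant bookkeeping over hypothesis-shaped `U ≡ 1` data and three composite letters of the coarse dressed object (the
sequels D-C∕D-D discharge them on the torus of record, D-E instantiates at Bałaban's `(Δ′_a⁻¹, Δ_a⁻¹)` hypothesis-free); abelianised scalar-multiplier coefficients (MODEL of (3.52)'s `V′(A)`),
(C3) block-average transport; NE2⁺ NOT printed ∕ proved; no statement of record touched; N15 NOT discharged; K3⁸ OPEN; counts UNMOVED (typed 28∕28 · discharged 5∕27); NOT infinite volume ∕ OS ∕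
mass gap ∕ Clay.
-/

noncomputable section

open scoped BigOperators
open Finset

namespace Summit.QuantumFields.YangMills.BalabanUVNodes.N15.TwoGrid

open Literature.MathematicalPhysics.QuantumFieldTheory.Balaban1983to89
open Literature.MathematicalPhysics.QuantumFieldTheory.Balaban1983to89.B11SectG (BlockNorm HasMaj hasMaj_comp hasMaj_comp_exp RowSum)
open Literature.MathematicalPhysics.QuantumFieldTheory.Balaban1983to89.T4EtaRateDefect (idef idef_apply idef_fix)
open Literature.MathematicalPhysics.QuantumFieldTheory.Balaban1983to89.T4EtaRateCoeffDefect (pull pull_apply diagK blockAvg hasMaj_idef_mulOp hasMaj_pull diagK_nonneg)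
open Literature.MathematicalPhysics.QuantumFieldTheory.Balaban1983to89.B9SectDWeightedNeumann (WRow wrow_of_exp neumann_majorant_wrow)
open Literature.MathematicalPhysics.QuantumFieldTheory.Balaban1983to89.B6RandomWalk (Triangle254)
open Literature.MathematicalPhysics.QuantumFieldTheory.Balaban1983to89.B6Prop26Gluing (mulOp mulOp_apply)
open Literature.MathematicalPhysics.QuantumFieldTheory.Balaban1983to89.B5Prop11Plancherel (Tor fine unitVec)
open Literature.MathematicalPhysics.QuantumFieldTheory.King1986.Torus (blockOf tdistT tdistT_nonneg)
open Literature.MathematicalPhysics.QuantumFieldTheory.Balaban1983to89.B6UnitTorusCarrier (unitTorusGeo triangle254_unitTorusGeo)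
open Summit.QuantumFields.YangMills.BalabanUVNodes.N15.VectorPiece (blkFine kingPrV blkFine_comp_kingPrV bshiftEquiv)
open Summit.QuantumFields.YangMills.BalabanUVNodes.N15.BackgroundModel (kappa_ofBlocks)
open Summit.QuantumFields.YangMills.BalabanUVNodes.N15.DerivDefect (exists_const_hasMaj_ofBlocks)
open Summit.QuantumFields.YangMills.BalabanUVNodes.N15.BackgroundLayer (bgPair projO abs_blockAvg_le hasMaj_fshift_comp hasMaj_idefFShift_comp hasMaj_step)
open Summit.QuantumFields.YangMills.BalabanUVNodes.N15.SiteLayer (hasMaj_exp_mono)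

variable {d : ℕ}

/-! ## §0 One piece of defect algebra -/

section Algebra

variable {F₁ F₂ : Type} [AddCommGroup F₁] [Module ℝ F₁] [AddCommGroup F₂] [Module ℝ F₂]

/-- ★ **THE DEFECT OF TWO TRANSLATION-FORM STEPS, APPLIED AFTER A COARSE OBJECT, EXPANDED** (Leibniz `idef_comp` twice, linearity in the multipliers):
`𝔇(G′(M′_c − Σ_μM′_{b_μ}) − Σ_μ S′_μM′_{a_μ}τ′_μ, G(M_c − Σ_μM_{b_μ}) − Σ_μ S_μM_{a_μ}τ_μ)∘Y = G′∘𝔇(M′_c, M_c)∘Y − Σ_μ G′∘𝔇(M′_{b_μ}, M_{b_μ})∘Y + 𝔇(G′,G)∘(M_c − Σ_μM_{b_μ})∘Y −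
Σ_μ [S′_μ∘(M′_{a_μ}∘𝔇(τ′_μ,τ_μ)∘Y + 𝔇(M′_{a_μ},M_{a_μ})∘τ_μ∘Y) + 𝔇(S′_μ,S_μ)∘M_{a_μ}∘τ_μ∘Y]` — abstract linear maps. [cite: Balaban1984PropagatorsII, (2.52)–(2.56) pp.232–233 (defect bookkeeping: shape)] -/
theorem idef_translate_expand {ι F₀ : Type} [Fintype ι] [AddCommGroup F₀] [Module ℝ F₀] (P : F₁ →ₗ[ℝ] F₂)
    (G Mc : F₁ →ₗ[ℝ] F₁) (G' Mc' : F₂ →ₗ[ℝ] F₂) (Mb S Ma τ : ι → F₁ →ₗ[ℝ] F₁) (Mb' S' Ma' τ' : ι → F₂ →ₗ[ℝ] F₂) (Y : F₀ →ₗ[ℝ] F₁) :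
    idef P P (G' ∘ₗ (Mc' - ∑ μ, Mb' μ) - ∑ μ, S' μ ∘ₗ (Ma' μ ∘ₗ τ' μ)) (G ∘ₗ (Mc - ∑ μ, Mb μ) - ∑ μ, S μ ∘ₗ (Ma μ ∘ₗ τ μ)) ∘ₗ Y =
      G' ∘ₗ (idef P P Mc' Mc ∘ₗ Y) - ∑ μ, G' ∘ₗ (idef P P (Mb' μ) (Mb μ) ∘ₗ Y) + idef P P G' G ∘ₗ ((Mc - ∑ μ, Mb μ) ∘ₗ Y) -
        ∑ μ, (S' μ ∘ₗ (Ma' μ ∘ₗ (idef P P (τ' μ) (τ μ) ∘ₗ Y) + idef P P (Ma' μ) (Ma μ) ∘ₗ (τ μ ∘ₗ Y)) +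
          idef P P (S' μ) (S μ) ∘ₗ (Ma μ ∘ₗ (τ μ ∘ₗ Y))) := by
  refine LinearMap.ext fun v => ?_
  simp only [idef, LinearMap.comp_apply, LinearMap.sub_apply, LinearMap.add_apply, LinearMap.sum_apply, map_sub, map_add, map_sum,
    Finset.sum_add_distrib, Finset.sum_sub_distrib]
  abel

end Algebra

/-! ## §20 ★★★ The η-defect of the dressed source divergence from letters -/

section Main

variable {L : ℕ} [NeZero L] (M : Fin (d + 1) → ℕ) [∀ μ, NeZero (M μ)] (k m : ℕ)

set_option maxHeartbeats 1600000 in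
/-- ★★★ **THE η-DEFECT OF THE DRESSED SOURCE DIVERGENCE OF THE FIRST-ORDER PAIR, FROM LETTERS — NO «∇G∇*», NO `∇c′`, NO FIT OF `c′`.**  See the module docstring (WHAT) for the reading; the
letters are the hypotheses `hG … hJ`, the guards `hq` (the jets' Neumann series) and `hqK` (the fine step's weighted row norm). [cite: Balaban1985BackgroundPropagators, Thm 3.1 (3.42) p.397 (entry
`G(U)∇*`: shape), (3.52) p.400, (3.62)–(3.65) pp.402–403 (mechanism), (3.35) p.396 (letters); Balaban1984PropagatorsI, Prop. 1.2 (1.110) p.35 (rows «G», «∇G», «G∇*»); King1986, p.664 (pairing)] -/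
theorem hasMaj_idef_dressedDiv_of_letters {σ cr : ℝ} (hσ : 0 ≤ σ) (hcr : 0 ≤ cr) (hrow : RowSum (unitTorusGeo L k M) σ cr) {ρ δ β C₁ C₂ mG mS r rb oa βY HY ζc ζb : ℝ} (hρ : 0 ≤ ρ)
    (hρδ : ρ + σ ≤ δ) (hβ : 0 ≤ β) (hC₁ : 0 ≤ C₁) (hC₂ : 0 ≤ C₂) (hmG : 0 ≤ mG) (hmS : 0 ≤ mS) (hr : 0 ≤ r) (hrb : 0 ≤ rb) (hoa : 0 ≤ oa) (hβY : 0 ≤ βY) (hHY : 0 ≤ HY)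
    (hζc : 0 ≤ ζc) (hζb : 0 ≤ ζb) (κ : Fin (d + 1))
    {G : (Tor (fine (L ^ k) M) × Fin (d + 1) → ℝ) →ₗ[ℝ] (Tor (fine (L ^ k) M) × Fin (d + 1) → ℝ)}
    {G' : (Tor (fine (L ^ m * L ^ k) M) × Fin (d + 1) → ℝ) →ₗ[ℝ] (Tor (fine (L ^ m * L ^ k) M) × Fin (d + 1) → ℝ)}
    {c' : Tor (fine (L ^ m * L ^ k) M) × Fin (d + 1) → ℝ} {a' : Fin (d + 1) → Tor (fine (L ^ m * L ^ k) M) × Fin (d + 1) → ℝ}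
    (hG : HasMaj (BlockNorm.ofBlocks (unitTorusGeo L k M) (blkFine L k M)) (BlockNorm.ofBlocks (unitTorusGeo L k M) (blkFine L k M)) G
      (fun y y' => β * Real.exp (-(δ * tdistT M y y'))))
    (hGD : ∀ μ, HasMaj (BlockNorm.ofBlocks (unitTorusGeo L k M) (blkFine L k M)) (BlockNorm.ofBlocks (unitTorusGeo L k M) (blkFine L k M))
      (symbOp M (L ^ k) (sD M (L ^ k) μ ((L ^ k : ℕ) : ℝ)) ∘ₗ G) (fun y y' => β * Real.exp (-(δ * tdistT M y y'))))
    (hG' : HasMaj (BlockNorm.ofBlocks (unitTorusGeo L k M) (fun i : Tor (fine (L ^ m * L ^ k) M) × Fin (d + 1) => blockOf (L ^ m * L ^ k) M i.1))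
      (BlockNorm.ofBlocks (unitTorusGeo L k M) (fun i : Tor (fine (L ^ m * L ^ k) M) × Fin (d + 1) => blockOf (L ^ m * L ^ k) M i.1)) G'
      (fun y y' => β * Real.exp (-(δ * tdistT M y y'))))
    (hG'D : ∀ μ, HasMaj (BlockNorm.ofBlocks (unitTorusGeo L k M) (fun i : Tor (fine (L ^ m * L ^ k) M) × Fin (d + 1) => blockOf (L ^ m * L ^ k) M i.1))
      (BlockNorm.ofBlocks (unitTorusGeo L k M) (fun i : Tor (fine (L ^ m * L ^ k) M) × Fin (d + 1) => blockOf (L ^ m * L ^ k) M i.1))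
      (symbOp M (L ^ m * L ^ k) (sD M (L ^ m * L ^ k) μ ((L ^ m * L ^ k : ℕ) : ℝ)) ∘ₗ G') (fun y y' => β * Real.exp (-(δ * tdistT M y y'))))
    (hG'grad : ∀ μ, HasMaj (BlockNorm.ofBlocks (unitTorusGeo L k M) (fun i : Tor (fine (L ^ m * L ^ k) M) × Fin (d + 1) => blockOf (L ^ m * L ^ k) M i.1))
      (BlockNorm.ofBlocks (unitTorusGeo L k M) (fun i : Tor (fine (L ^ m * L ^ k) M) × Fin (d + 1) => blockOf (L ^ m * L ^ k) M i.1))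
      (G' ∘ₗ symbOp M (L ^ m * L ^ k) (sD M (L ^ m * L ^ k) μ ((L ^ m * L ^ k : ℕ) : ℝ))) (fun y y' => C₂ * Real.exp (-(δ * tdistT M y y'))))
    (hG'div : ∀ μ : Fin (d + 1), HasMaj (BlockNorm.ofBlocks (unitTorusGeo L k M) (fun i : Tor (fine (L ^ m * L ^ k) M) × Fin (d + 1) => blockOf (L ^ m * L ^ k) M i.1))
      (BlockNorm.ofBlocks (unitTorusGeo L k M) (fun i : Tor (fine (L ^ m * L ^ k) M) × Fin (d + 1) => blockOf (L ^ m * L ^ k) M i.1))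
      (G' ∘ₗ symbOp M (L ^ m * L ^ k) (((L ^ m * L ^ k : ℕ) : ℝ) • (sTinv M (L ^ m * L ^ k) μ - 1))) (fun y y' => C₁ * Real.exp (-(δ * tdistT M y y'))))
    (hDG : HasMaj (BlockNorm.ofBlocks (unitTorusGeo L k M) (blkFine L k M))
      (BlockNorm.ofBlocks (unitTorusGeo L k M) (fun i : Tor (fine (L ^ m * L ^ k) M) × Fin (d + 1) => blockOf (L ^ m * L ^ k) M i.1))
      (idef (pull (kingPrV L k m M)) (pull (kingPrV L k m M)) G' G) (fun y y' => mG * Real.exp (-(δ * tdistT M y y'))))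
    (hDS : ∀ μ : Fin (d + 1), HasMaj (BlockNorm.ofBlocks (unitTorusGeo L k M) (blkFine L k M))
      (BlockNorm.ofBlocks (unitTorusGeo L k M) (fun i : Tor (fine (L ^ m * L ^ k) M) × Fin (d + 1) => blockOf (L ^ m * L ^ k) M i.1))
      (idef (pull (kingPrV L k m M)) (pull (kingPrV L k m M)) (G' ∘ₗ symbOp M (L ^ m * L ^ k) (((L ^ m * L ^ k : ℕ) : ℝ) • (sTinv M (L ^ m * L ^ k) μ - 1)))
        (G ∘ₗ symbOp M (L ^ k) (((L ^ k : ℕ) : ℝ) • (sTinv M (L ^ k) μ - 1)))) (fun y y' => mS * Real.exp (-(δ * tdistT M y y'))))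
    (hc' : ∀ z, |c' z| ≤ r) (ha' : ∀ μ z, |a' μ z| ≤ r)
    (hb' : ∀ μ z, |((L ^ m * L ^ k : ℕ) : ℝ) * (a' μ z - a' μ (z.1 - unitVec (fine (L ^ m * L ^ k) M) μ, z.2))| ≤ rb)
    (hbq : ∀ μ z, |((L ^ k : ℕ) : ℝ) * (blockAvg (kingPrV L k m M) (a' μ) z - blockAvg (kingPrV L k m M) (a' μ) (z.1 - unitVec (fine (L ^ k) M) μ, z.2))| ≤ rb)
    (hfa : ∀ μ z, |a' μ z - blockAvg (kingPrV L k m M) (a' μ) (kingPrV L k m M z)| ≤ oa)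
    -- the three composite letters of the coarse dressed source divergence `Ȳ = X̄∘∇̄*_κ`
    (hY : HasMaj (BlockNorm.ofBlocks (unitTorusGeo L k M) (blkFine L k M)) (BlockNorm.ofBlocks (unitTorusGeo L k M) (blkFine L k M))
      ((projO none ∘ₗ bgPair G (fun μ => symbOp M (L ^ k) (sD M (L ^ k) μ ((L ^ k : ℕ) : ℝ)) ∘ₗ G) (blockAvg (kingPrV L k m M) c')
          (fun μ => blockAvg (kingPrV L k m M) (a' μ))) ∘ₗ symbOp M (L ^ k) (((L ^ k : ℕ) : ℝ) • (sTinv M (L ^ k) κ - 1)))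
      (fun y y' => βY * Real.exp (-(ρ * tdistT M y y'))))
    (hYstep : ∀ ι : Fin (d + 1), HasMaj (BlockNorm.ofBlocks (unitTorusGeo L k M) (blkFine L k M)) (BlockNorm.ofBlocks (unitTorusGeo L k M) (blkFine L k M))
      ((pull ⇑(bshiftEquiv M (L ^ k) ι) - LinearMap.id) ∘ₗ
        ((projO none ∘ₗ bgPair G (fun μ => symbOp M (L ^ k) (sD M (L ^ k) μ ((L ^ k : ℕ) : ℝ)) ∘ₗ G) (blockAvg (kingPrV L k m M) c')
          (fun μ => blockAvg (kingPrV L k m M) (a' μ))) ∘ₗ symbOp M (L ^ k) (((L ^ k : ℕ) : ℝ) • (sTinv M (L ^ k) κ - 1))))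
      (fun y y' => HY * Real.exp (-(ρ * tdistT M y y'))))
    (hGc : HasMaj (BlockNorm.ofBlocks (unitTorusGeo L k M) (blkFine L k M))
      (BlockNorm.ofBlocks (unitTorusGeo L k M) (fun i : Tor (fine (L ^ m * L ^ k) M) × Fin (d + 1) => blockOf (L ^ m * L ^ k) M i.1))
      (G' ∘ₗ idef (pull (kingPrV L k m M)) (pull (kingPrV L k m M)) (mulOp c') (mulOp (blockAvg (kingPrV L k m M) c'))) (fun y y' => ζc * Real.exp (-(δ * tdistT M y y'))))
    (hJb : ∀ μ : Fin (d + 1), HasMaj (BlockNorm.ofBlocks (unitTorusGeo L k M) (blkFine L k M))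
      (BlockNorm.ofBlocks (unitTorusGeo L k M) (fun i : Tor (fine (L ^ m * L ^ k) M) × Fin (d + 1) => blockOf (L ^ m * L ^ k) M i.1))
      (G' ∘ₗ (idef (pull (kingPrV L k m M)) (pull (kingPrV L k m M))
          (mulOp fun z => ((L ^ m * L ^ k : ℕ) : ℝ) * (a' μ z - a' μ (z.1 - unitVec (fine (L ^ m * L ^ k) M) μ, z.2)))
          (mulOp fun z => ((L ^ k : ℕ) : ℝ) * (blockAvg (kingPrV L k m M) (a' μ) z - blockAvg (kingPrV L k m M) (a' μ) (z.1 - unitVec (fine (L ^ k) M) μ, z.2))) ∘ₗ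
        ((projO none ∘ₗ bgPair G (fun μ => symbOp M (L ^ k) (sD M (L ^ k) μ ((L ^ k : ℕ) : ℝ)) ∘ₗ G) (blockAvg (kingPrV L k m M) c')
            (fun μ => blockAvg (kingPrV L k m M) (a' μ))) ∘ₗ symbOp M (L ^ k) (((L ^ k : ℕ) : ℝ) • (sTinv M (L ^ k) κ - 1)))))
      (fun y y' => ζb * Real.exp (-(ρ * tdistT M y y'))))
    (hq : β * (r * (d + 2)) * cr < 1) (hqK : (β * r + (d + 1) * (C₂ * r + β * rb)) * cr < 1) :
    HasMaj (BlockNorm.ofBlocks (unitTorusGeo L k M) (blkFine L k M))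
      (BlockNorm.ofBlocks (unitTorusGeo L k M) (fun i : Tor (fine (L ^ m * L ^ k) M) × Fin (d + 1) => blockOf (L ^ m * L ^ k) M i.1))
      (idef (pull (kingPrV L k m M)) (pull (kingPrV L k m M))
        ((projO none ∘ₗ bgPair G' (fun μ => symbOp M (L ^ m * L ^ k) (sD M (L ^ m * L ^ k) μ ((L ^ m * L ^ k : ℕ) : ℝ)) ∘ₗ G') c' a') ∘ₗ
          symbOp M (L ^ m * L ^ k) (((L ^ m * L ^ k : ℕ) : ℝ) • (sTinv M (L ^ m * L ^ k) κ - 1)))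
        ((projO none ∘ₗ bgPair G (fun μ => symbOp M (L ^ k) (sD M (L ^ k) μ ((L ^ k : ℕ) : ℝ)) ∘ₗ G) (blockAvg (kingPrV L k m M) c')
            (fun μ => blockAvg (kingPrV L k m M) (a' μ))) ∘ₗ symbOp M (L ^ k) (((L ^ k : ℕ) : ℝ) • (sTinv M (L ^ k) κ - 1))))
      (fun y y' =>
        (mS + mG * ((r + (d + 1) * rb) * βY) * cr + ζc * βY * cr + (d + 1) * ζb +
            (d + 1) * (mS * (r * (βY * Real.exp ρ)) * cr + C₁ * oa * (βY * Real.exp ρ) * cr + C₁ * r * HY * cr)) *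
          (1 - (β * r + (d + 1) * (C₂ * r + β * rb)) * cr)⁻¹ * Real.exp (-(ρ * tdistT M y y'))) := by
  -- geometry and bookkeeping
  have htri : Triangle254 (unitTorusGeo L k M) := triangle254_unitTorusGeo L k M
  have hd : ∀ a b : (unitTorusGeo L k M).Site, 0 ≤ (unitTorusGeo L k M).dist a b := fun a b => tdistT_nonneg M a b
  have hρδ' : ρ ≤ δ := by linarith
  set θK : ℝ := β * r + (d + 1) * (C₂ * r + β * rb) with hθK_def
  have hθK : 0 ≤ θK := by positivity
  have hR : r * (1 + (Fintype.card (Fin (d + 1)) : ℝ)) ≤ r * (d + 2) := by rw [Fintype.card_fin]; push_cast; exact le_of_eq (by ring)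
  -- names
  set P := pull (kingPrV L k m M) with hP_def
  set bc := BlockNorm.ofBlocks (unitTorusGeo L k M) (blkFine L k M) with hbc
  set bf := BlockNorm.ofBlocks (unitTorusGeo L k M) (fun i : Tor (fine (L ^ m * L ^ k) M) × Fin (d + 1) => blockOf (L ^ m * L ^ k) M i.1) with hbf
  set Dc : Fin (d + 1) → (Tor (fine (L ^ k) M) × Fin (d + 1) → ℝ) →ₗ[ℝ] (Tor (fine (L ^ k) M) × Fin (d + 1) → ℝ) :=
    fun μ => symbOp M (L ^ k) (sD M (L ^ k) μ ((L ^ k : ℕ) : ℝ)) with hDc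
  set Df : Fin (d + 1) → (Tor (fine (L ^ m * L ^ k) M) × Fin (d + 1) → ℝ) →ₗ[ℝ] (Tor (fine (L ^ m * L ^ k) M) × Fin (d + 1) → ℝ) :=
    fun μ => symbOp M (L ^ m * L ^ k) (sD M (L ^ m * L ^ k) μ ((L ^ m * L ^ k : ℕ) : ℝ)) with hDf
  set Ec : Fin (d + 1) → (Tor (fine (L ^ k) M) × Fin (d + 1) → ℝ) →ₗ[ℝ] (Tor (fine (L ^ k) M) × Fin (d + 1) → ℝ) :=
    fun μ => symbOp M (L ^ k) (((L ^ k : ℕ) : ℝ) • (sTinv M (L ^ k) μ - 1)) with hEc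
  set Ef : Fin (d + 1) → (Tor (fine (L ^ m * L ^ k) M) × Fin (d + 1) → ℝ) →ₗ[ℝ] (Tor (fine (L ^ m * L ^ k) M) × Fin (d + 1) → ℝ) :=
    fun μ => symbOp M (L ^ m * L ^ k) (((L ^ m * L ^ k : ℕ) : ℝ) • (sTinv M (L ^ m * L ^ k) μ - 1)) with hEf
  set τc : Fin (d + 1) → (Tor (fine (L ^ k) M) × Fin (d + 1) → ℝ) →ₗ[ℝ] (Tor (fine (L ^ k) M) × Fin (d + 1) → ℝ) :=
    fun μ => symbOp M (L ^ k) (sT M (L ^ k) μ) with hτc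
  set τf : Fin (d + 1) → (Tor (fine (L ^ m * L ^ k) M) × Fin (d + 1) → ℝ) →ₗ[ℝ] (Tor (fine (L ^ m * L ^ k) M) × Fin (d + 1) → ℝ) :=
    fun μ => symbOp M (L ^ m * L ^ k) (sT M (L ^ m * L ^ k) μ) with hτf
  set c : Tor (fine (L ^ k) M) × Fin (d + 1) → ℝ := blockAvg (kingPrV L k m M) c' with hc_def
  set a : Fin (d + 1) → Tor (fine (L ^ k) M) × Fin (d + 1) → ℝ := fun μ => blockAvg (kingPrV L k m M) (a' μ) with ha_def
  set bf' : Fin (d + 1) → Tor (fine (L ^ m * L ^ k) M) × Fin (d + 1) → ℝ :=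
    fun μ z => ((L ^ m * L ^ k : ℕ) : ℝ) * (a' μ z - a' μ (z.1 - unitVec (fine (L ^ m * L ^ k) M) μ, z.2)) with hbf'_def
  set bq : Fin (d + 1) → Tor (fine (L ^ k) M) × Fin (d + 1) → ℝ := fun μ z => ((L ^ k : ℕ) : ℝ) * (a μ z - a μ (z.1 - unitVec (fine (L ^ k) M) μ, z.2)) with hbq_def
  set wc : Tor (fine (L ^ k) M) × Fin (d + 1) → ℝ := fun z => c z - ∑ μ, bq μ z with hwc_def
  set Xv := projO none ∘ₗ bgPair G (fun μ => Dc μ ∘ₗ G) c a with hXv_def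
  set Xv' := projO none ∘ₗ bgPair G' (fun μ => Df μ ∘ₗ G') c' a' with hXv'_def
  set Yc := Xv ∘ₗ Ec κ with hYc_def
  set Yf := Xv' ∘ₗ Ef κ with hYf_def
  set Kc := G ∘ₗ (mulOp c + ∑ μ, mulOp (a μ) ∘ₗ Dc μ) with hKc_def
  set Kf := G' ∘ₗ (mulOp c' + ∑ μ, mulOp (a' μ) ∘ₗ Df μ) with hKf_def
  -- coarse coefficients
  have hc : ∀ x, |c x| ≤ r := abs_blockAvg_le (kingPrV L k m M) hr hc'
  have ha : ∀ μ x, |a μ x| ≤ r := fun μ => abs_blockAvg_le (kingPrV L k m M) hr (ha' μ)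
  have hRw : 0 ≤ r + (d + 1) * rb := by positivity
  have hwc : ∀ z, |wc z| ≤ r + (d + 1) * rb := by
    intro z
    have h1 : |∑ μ, bq μ z| ≤ ∑ _μ : Fin (d + 1), rb := (Finset.abs_sum_le_sum_abs _ _).trans (Finset.sum_le_sum fun μ _ => hbq μ z)
    rw [sum_const, card_univ, Fintype.card_fin, nsmul_eq_mul] at h1
    calc |wc z| = |c z - ∑ μ, bq μ z| := rfl
      _ ≤ |c z| + |∑ μ, bq μ z| := abs_sub _ _
      _ ≤ r + (d + 1) * rb := add_le_add (hc z) (by push_cast at h1 ⊢; linarith)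
  -- the two units (II-B §18)
  have hunit := (hasMaj_bgPair_comp (g := unitTorusGeo L k M) (blkFine L k M) (Dc := Dc) htri hd hrow hσ hρ hρδ hβ hr hG hGD hc ha hR hq none).1
  have hunit' := (hasMaj_bgPair_comp (g := unitTorusGeo L k M) (fun i : Tor (fine (L ^ m * L ^ k) M) × Fin (d + 1) => blockOf (L ^ m * L ^ k) M i.1) (Dc := Df)
    htri hd hrow hσ hρ hρδ hβ hr hG' hG'D hc' ha' hR hq none).1
  -- ★★ THE TWO FIXED POINTS of the dressed source divergence (D-A)
  have hfixc : Yc = G ∘ₗ Ec κ + Kc ∘ₗ Yc := bgPairDiv_fix hunit (Ec κ)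
  have hfixf : Yf = G' ∘ₗ Ef κ + Kf ∘ₗ Yf := bgPairDiv_fix hunit' (Ef κ)
  have hID := idef_fix P P hfixc hfixf
  -- THE STEP and its weighted row norm (II-B §17)
  have hK : HasMaj bf bf Kf (fun y y' => θK * Real.exp (-(δ * tdistT M y y'))) :=
    hasMaj_byPartsStep M k (L ^ m * L ^ k) hβ hC₂ hr hr hrb hG' hG'grad hc' ha' hb'
  have hwrow : WRow (unitTorusGeo L k M) ρ (fun y y' => θK * Real.exp (-(δ * tdistT M y y'))) (θK * cr) := wrow_of_exp (g := unitTorusGeo L k M) hd hrow hθK hρδ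
  -- ★ THE STEPS IN TRANSLATION FORM (D-A) and the expansion of their defect
  have hKc : Kc = G ∘ₗ (mulOp c - ∑ μ, mulOp (bq μ)) - ∑ μ, (G ∘ₗ Ec μ) ∘ₗ (mulOp (a μ) ∘ₗ τc μ) :=
    comp_firstOrder_eq_translate M (L ^ k) G ((L ^ k : ℕ) : ℝ) c a
  have hKf : Kf = G' ∘ₗ (mulOp c' - ∑ μ, mulOp (bf' μ)) - ∑ μ, (G' ∘ₗ Ef μ) ∘ₗ (mulOp (a' μ) ∘ₗ τf μ) :=
    comp_firstOrder_eq_translate M (L ^ m * L ^ k) G' ((L ^ m * L ^ k : ℕ) : ℝ) c' a'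
  have hDK : idef P P Kf Kc ∘ₗ Yc =
      G' ∘ₗ (idef P P (mulOp c') (mulOp c) ∘ₗ Yc) - ∑ μ, G' ∘ₗ (idef P P (mulOp (bf' μ)) (mulOp (bq μ)) ∘ₗ Yc) +
          idef P P G' G ∘ₗ ((mulOp c - ∑ μ, mulOp (bq μ)) ∘ₗ Yc) -
        ∑ μ, ((G' ∘ₗ Ef μ) ∘ₗ ((mulOp (a' μ) ∘ₗ (idef P P (τf μ) (τc μ) ∘ₗ Yc)) + idef P P (mulOp (a' μ)) (mulOp (a μ)) ∘ₗ (τc μ ∘ₗ Yc)) +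
          idef P P (G' ∘ₗ Ef μ) (G ∘ₗ Ec μ) ∘ₗ (mulOp (a μ) ∘ₗ (τc μ ∘ₗ Yc))) := by
    rw [hKf, hKc]
    exact idef_translate_expand P G (mulOp c) G' (mulOp c') (fun μ => mulOp (bq μ)) (fun μ => G ∘ₗ Ec μ) (fun μ => mulOp (a μ)) τc (fun μ => mulOp (bf' μ))
      (fun μ => G' ∘ₗ Ef μ) (fun μ => mulOp (a' μ)) τf Yc
  -- THE SOURCE TERM, summand by summand (all at the rate `ρ`)
  have hEρ : ∀ y y' : Tor M, 0 ≤ Real.exp (-(ρ * tdistT M y y')) := fun _ _ => Real.exp_nonneg _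
  -- (s0) `𝔇(S_κ)`
  have hS0 : HasMaj bc bf (idef P P (G' ∘ₗ Ef κ) (G ∘ₗ Ec κ)) (fun y y' => mS * Real.exp (-(ρ * tdistT M y y'))) :=
    hasMaj_exp_mono (g := unitTorusGeo L k M) hd hmS hρδ' (hDS κ)
  -- (s1) `G′∘𝔇(M_{c′},M_{c̄})∘Ȳ` — THE NO-FIT ROW of the zeroth-order coefficient (M-C's shape)
  have hS1 : HasMaj bc bf (G' ∘ₗ (idef P P (mulOp c') (mulOp c) ∘ₗ Yc)) (fun y y' => bc.κ * ζc * βY * cr * Real.exp (-(ρ * tdistT M y y'))) := by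
    rw [← LinearMap.comp_assoc]
    exact hasMaj_comp_exp (b₁ := bc) (b₂ := bc) (b₃ := bf) htri hd hrow hζc hβY hρ le_rfl hρδ hGc hY
  -- (s2) THE JUNK LETTERS of the by-parts remainders, one per direction
  have hS2 := hasMaj_finsum (b₁ := bc) (b₂ := bf) Finset.univ (fun μ => G' ∘ₗ (idef P P (mulOp (bf' μ)) (mulOp (bq μ)) ∘ₗ Yc))
    (fun _ y y' => ζb * Real.exp (-(ρ * tdistT M y y'))) fun μ _ => hJb μ
  -- (s3) `𝔇(G)∘(M_{c̄} − Σ_μ M_{b̄_μ})∘Ȳ`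
  have hW : HasMaj bc bc ((mulOp c - ∑ μ, mulOp (bq μ)) ∘ₗ Yc) (fun y y' => (r + (d + 1) * rb) * (βY * Real.exp (-(ρ * tdistT M y y')))) := by
    rw [mulOp_sub_sum_mulOp]
    exact hasMaj_mulOp_comp (g := unitTorusGeo L k M) (blkFine L k M) (fun _ _ => mul_nonneg hβY (Real.exp_nonneg _)) hRw hwc hY
  have hW' : HasMaj bc bc ((mulOp c - ∑ μ, mulOp (bq μ)) ∘ₗ Yc) (fun y y' => ((r + (d + 1) * rb) * βY) * Real.exp (-(ρ * (unitTorusGeo L k M).dist y y'))) :=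
    hW.mono fun y y' => le_of_eq (by ring)
  have hS3 : HasMaj bc bf (idef P P G' G ∘ₗ ((mulOp c - ∑ μ, mulOp (bq μ)) ∘ₗ Yc))
      (fun y y' => bc.κ * mG * ((r + (d + 1) * rb) * βY) * cr * Real.exp (-(ρ * tdistT M y y'))) :=
    hasMaj_comp_exp (b₁ := bc) (b₂ := bc) (b₃ := bf) htri hd hrow hmG (mul_nonneg hRw hβY) hρ le_rfl hρδ hDG hW'
  -- per direction: the shifted coarse object
  have hτY : ∀ μ, HasMaj bc bc (τc μ ∘ₗ Yc) (fun y y' => βY * Real.exp ρ * Real.exp (-(ρ * tdistT M y y'))) := by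
    intro μ
    have h := hasMaj_fshift_comp M k (L ^ k) (b₁ := bc) hβY hρ μ hY
    rw [← BackgroundLayer.symbOp_sT_eq_pull] at h
    exact h
  have hβYρ : 0 ≤ βY * Real.exp ρ := by positivity
  -- (s4) `𝔇(S_μ)∘M_ā∘τ̄∘Ȳ`
  have hS4 : ∀ μ, HasMaj bc bf (idef P P (G' ∘ₗ Ef μ) (G ∘ₗ Ec μ) ∘ₗ (mulOp (a μ) ∘ₗ (τc μ ∘ₗ Yc)))
      (fun y y' => bc.κ * mS * (r * (βY * Real.exp ρ)) * cr * Real.exp (-(ρ * tdistT M y y'))) := by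
    intro μ
    have hA : HasMaj bc bc (mulOp (a μ) ∘ₗ (τc μ ∘ₗ Yc)) (fun y y' => (r * (βY * Real.exp ρ)) * Real.exp (-(ρ * (unitTorusGeo L k M).dist y y'))) :=
      (hasMaj_mulOp_comp (g := unitTorusGeo L k M) (blkFine L k M) (fun _ _ => mul_nonneg hβYρ (Real.exp_nonneg _)) hr (ha μ) (hτY μ)).mono
        fun y y' => le_of_eq (by ring)
    exact hasMaj_comp_exp (b₁ := bc) (b₂ := bc) (b₃ := bf) htri hd hrow hmS (mul_nonneg hr hβYρ) hρ le_rfl hρδ (hDS μ) hA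
  -- (s5) `S′_μ∘𝔇(M_{a′},M_ā)∘τ̄∘Ȳ` — the pointwise fit of the first-order coefficient
  have hS5 : ∀ μ, HasMaj bc bf ((G' ∘ₗ Ef μ) ∘ₗ (idef P P (mulOp (a' μ)) (mulOp (a μ)) ∘ₗ (τc μ ∘ₗ Yc)))
      (fun y y' => bc.κ * (C₁ * oa) * (βY * Real.exp ρ) * cr * Real.exp (-(ρ * tdistT M y y'))) := by
    intro μ
    have hfit := hasMaj_idef_mulOp (g := unitTorusGeo L k M) (blkFine L k M) (kingPrV L k m M) (a' := a' μ) (a := a μ) (o := fun _ => oa) (fun _ => hoa)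
      fun z => hfa μ z
    rw [blkFine_comp_kingPrV] at hfit
    have hO : HasMaj bc bf ((G' ∘ₗ Ef μ) ∘ₗ idef P P (mulOp (a' μ)) (mulOp (a μ))) (fun y y' => C₁ * oa * Real.exp (-(δ * (unitTorusGeo L k M).dist y y'))) :=
      hasMaj_comp_diagK_const (g := unitTorusGeo L k M) (fun i : Tor (fine (L ^ m * L ^ k) M) × Fin (d + 1) => blockOf (L ^ m * L ^ k) M i.1) (blkFine L k M) hC₁
        (hG'div μ) hfit
    have h := hasMaj_comp_exp (b₁ := bc) (b₂ := bc) (b₃ := bf) htri hd hrow (mul_nonneg hC₁ hoa) hβYρ hρ le_rfl hρδ hO (hτY μ)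
    rw [← LinearMap.comp_assoc]
    exact h
  -- (s6) `S′_μ∘M_{a′}∘𝔇(τ′,τ̄)∘Ȳ` — THE SHIFT DEFECT, PAID BY ONE COARSE STEP OF THE DRESSED OBJECT
  have hS6 : ∀ μ, HasMaj bc bf ((G' ∘ₗ Ef μ) ∘ₗ (mulOp (a' μ) ∘ₗ (idef P P (τf μ) (τc μ) ∘ₗ Yc)))
      (fun y y' => bc.κ * (C₁ * r) * HY * cr * Real.exp (-(ρ * tdistT M y y'))) := by
    intro μ
    have hstep := hYstep μ
    have hsh := hasMaj_idefFShift_comp M k m (b₁ := bc) (fun _ _ => mul_nonneg hHY (Real.exp_nonneg _)) μ hstep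
    rw [blkFine_comp_kingPrV, ← BackgroundLayer.symbOp_sT_eq_pull, ← BackgroundLayer.symbOp_sT_eq_pull] at hsh
    have hfront : HasMaj bf bf ((G' ∘ₗ Ef μ) ∘ₗ mulOp (a' μ)) (fun y y' => C₁ * r * Real.exp (-(δ * (unitTorusGeo L k M).dist y y'))) :=
      hasMaj_step (g := unitTorusGeo L k M) (fun i : Tor (fine (L ^ m * L ^ k) M) × Fin (d + 1) => blockOf (L ^ m * L ^ k) M i.1) hC₁ hr (hG'div μ) (ha' μ)
    have h := hasMaj_comp_exp (b₁ := bc) (b₂ := bf) (b₃ := bf) htri hd hrow (mul_nonneg hC₁ hr) hHY hρ le_rfl hρδ hfront hsh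
    rw [LinearMap.comp_assoc] at h
    exact h
  -- per-direction total
  have hSμ := hasMaj_finsum (b₁ := bc) (b₂ := bf) Finset.univ
    (fun μ => ((G' ∘ₗ Ef μ) ∘ₗ ((mulOp (a' μ) ∘ₗ (idef P P (τf μ) (τc μ) ∘ₗ Yc)) + idef P P (mulOp (a' μ)) (mulOp (a μ)) ∘ₗ (τc μ ∘ₗ Yc)) +
      idef P P (G' ∘ₗ Ef μ) (G ∘ₗ Ec μ) ∘ₗ (mulOp (a μ) ∘ₗ (τc μ ∘ₗ Yc))))
    (fun _ y y' => (bc.κ * (C₁ * r) * HY * cr * Real.exp (-(ρ * tdistT M y y')) + bc.κ * (C₁ * oa) * (βY * Real.exp ρ) * cr * Real.exp (-(ρ * tdistT M y y'))) +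
      bc.κ * mS * (r * (βY * Real.exp ρ)) * cr * Real.exp (-(ρ * tdistT M y y')))
    fun μ _ => by
      have h56 : HasMaj bc bf ((G' ∘ₗ Ef μ) ∘ₗ ((mulOp (a' μ) ∘ₗ (idef P P (τf μ) (τc μ) ∘ₗ Yc)) + idef P P (mulOp (a' μ)) (mulOp (a μ)) ∘ₗ (τc μ ∘ₗ Yc)))
          (fun y y' => bc.κ * (C₁ * r) * HY * cr * Real.exp (-(ρ * tdistT M y y')) + bc.κ * (C₁ * oa) * (βY * Real.exp ρ) * cr * Real.exp (-(ρ * tdistT M y y'))) := by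
        rw [LinearMap.comp_add]
        exact (hS6 μ).add (hS5 μ)
      exact h56.add (hS4 μ)
  -- `S` altogether
  set A : ℝ := mS + mG * ((r + (d + 1) * rb) * βY) * cr + ζc * βY * cr + (d + 1) * ζb +
      (d + 1) * (mS * (r * (βY * Real.exp ρ)) * cr + C₁ * oa * (βY * Real.exp ρ) * cr + C₁ * r * HY * cr) with hA_def
  have hA : 0 ≤ A := by positivity
  have hS : HasMaj bc bf (idef P P (G' ∘ₗ Ef κ) (G ∘ₗ Ec κ) + idef P P Kf Kc ∘ₗ Yc) (fun y y' => A * Real.exp (-(ρ * tdistT M y y'))) := by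
    rw [hDK]
    refine (hS0.add (((hS1.sub hS2).add hS3).sub hSμ)).mono fun y y' => le_of_eq ?_
    rw [sum_const, sum_const, card_univ, Fintype.card_fin, nsmul_eq_mul, nsmul_eq_mul, hA_def]
    simp only [hbc, kappa_ofBlocks]
    push_cast
    ring
  -- a priori bound on the finite lattice, and the Neumann majorant
  obtain ⟨M₀, hM₀, hap⟩ := exists_const_hasMaj_ofBlocks (g := unitTorusGeo L k M) (blkFine L k M)
    (fun i : Tor (fine (L ^ m * L ^ k) M) × Fin (d + 1) => blockOf (L ^ m * L ^ k) M i.1) (idef P P Yf Yc)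
  have hq2 : bf.κ * (θK * cr) < 1 := by rw [hbf, kappa_ofBlocks, one_mul]; exact hqK
  have key := neumann_majorant_wrow htri hd hρ (fun _ _ => mul_nonneg hθK (Real.exp_nonneg _)) hwrow hA hM₀ hK hS hID hap hq2
  refine key.mono fun y y' => le_of_eq ?_
  rw [hbf, kappa_ofBlocks, one_mul]

end Main

end Summit.QuantumFields.YangMills.BalabanUVNodes.N15.TwoGrid

end
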